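import Summits.Langlands.Langlands.Theses.PhantomRMYoshida
import HarnessLib

/-!
# BIRTH SKELETON — piece A `AutomorphicToGaloisOfDatum` of the split of `PhantomRMYoshida.PhantomRMJunction`
(stmt-Langlands-13643). Crux-strategist planner-cstrat-stmt-Langlands-13643-r1-0, 2026-08-17.

`A′ := ∀ F, Nonempty (ReciprocityData F) → ∃ Rec, ∀ n>0 hcpt, AutomorphicToGalois n Rec hcpt` — direction (A) of
reciprocity (Clozel 1990 Conj 4.5 / Buzzard–Gee 2014 Conj 3.2.2 / Taylor 2004 Conj 7) for SOME pinned datum, all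
`n`, all number fields.  Stubs, cut along the seams of the conjecture (the texts of the shared leaves W / LGC of
the sub's frame lines on stmt-Langlands-14328 / 10368 / 12840, here with irreducibility folded into W and the
`∃ Rec` guarded by non-vacuity):
* `stub_weakExistenceIrreducible` (W_irr) — an L-algebraic cuspidal `π` has an IRREDUCIBLE pinned-geometric
  `ℓ`-adic avatar, Satake–Frobenius compatible a.e. (open core of (A); `Rec`-free);
* `stub_pairCompatibility` (LGC_∃) — Taylor's Conj 7 at EVERY finite place for irreducible pinned-geometric
  a.e.-compatible pairs, for SOME pinned datum (given that pinned data exist);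
* `stub_avatarConjugate` — two representations corresponding to the same cuspidal `π`, one irreducible, are
  conjugate (THEOREM: Chebotarev density + Brauer–Nesbitt + Jordan–Hölder; L-sized in the tree: the landed
  `FramedGaloisRep.nonempty_equiv_of_hasFrobCharpolyAt_eventually` needs semisimplicity of BOTH sides).
Composition `automorphicToGaloisOfDatum_text_of` (sorry-free outside the three stubs); the by-name
`AutomorphicToGaloisOfDatum_proof` is appended once the split has written the child decl.
-/

noncomputable section

set_option linter.dupNamespace false

open scoped MatrixGroups NumberField
open NumberField IsDedekindDomain Filter
open Literature.NumberTheory.Automorphic Literature.NumberTheory.GaloisRepresentations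
open Summit.Langlands

namespace Summit.Langlands.Langlands.Cruxes.PhantomRMJunction.BirthA

/-- **Stub W_irr — weak existence of an irreducible pinned-geometric avatar** (Buzzard–Gee Conj 3.2.2, weak
form, with irreducibility; `Rec`-free). [cite: BuzzardGeeLMS2014, Conj. 3.2.2] -/
theorem stub_weakExistenceIrreducible :
    ∀ (K : Type) [Field K] [NumberField K] (n : ℕ) (hcpt : Literature.NumberTheory.Automorphic.isCompact_glFiniteIntegralLevel n K), 0 < n → ∀ π : Literature.NumberTheory.Automorphic.CuspidalAutomorphicRepData n K hcpt, π.1.IsLAlgebraic → ∀ (ℓ : ℕ) [Fact ℓ.Prime] (ι : PadicAlgCl ℓ ≃+* ℂ), ∃ ρ : Literature.NumberTheory.GaloisRepresentations.FramedGaloisRep K (PadicAlgCl ℓ) n, ρ.toGaloisRep.IsIrreducible ∧ ((∀ᶠ v : IsDedekindDomain.HeightOneSpectrum (NumberField.RingOfIntegers K) in Filter.cofinite, ρ.IsUnramifiedAt v) ∧ ∀ (v : IsDedekindDomain.HeightOneSpectrum (NumberField.RingOfIntegers K)) (hv : ((ℓ : ℕ) : NumberField.RingOfIntegers K) ∈ v.asIdeal),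 (Literature.NumberTheory.PAdicHodge.fontainePstAdicCompletion v ℓ hv).IsDeRhamFramed (ρ.toLocal v)) ∧ ∀ᶠ v : IsDedekindDomain.HeightOneSpectrum (NumberField.RingOfIntegers K) in Filter.cofinite, Summit.Langlands.SatakeFrobCompatibleAt ι π.1 ρ v := by
  sorry

/-- **Stub LGC_∃ — local–global compatibility at every finite place for irreducible a.e.-compatible pairs,
for SOME pinned reciprocity datum** (Taylor 2004 Conj 7; Harris–Taylor / Taylor–Yoshida / Caraiani in the
regular polarised case). [cite: TaylorGaloisRepresentations2004, Conj. 7] [cite: HarrisTaylorAMS2001, Thm. A] -/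
theorem stub_pairCompatibility :
    ∀ (K : Type) [Field K] [NumberField K], Nonempty (Summit.Langlands.ReciprocityData K) → ∃ Rec : Summit.Langlands.ReciprocityData K, ∀ (n : ℕ) (hcpt : Literature.NumberTheory.Automorphic.isCompact_glFiniteIntegralLevel n K), 0 < n → ∀ (π : Literature.NumberTheory.Automorphic.CuspidalAutomorphicRepData n K hcpt), π.1.IsLAlgebraic → ∀ (ℓ : ℕ) [Fact ℓ.Prime] (ι : PadicAlgCl ℓ ≃+* ℂ) (ρ : Literature.NumberTheory.GaloisRepresentations.FramedGaloisRep K (PadicAlgCl ℓ) n), ρ.toGaloisRep.IsIrreducible → ((∀ᶠ v : IsDedekindDomain.HeightOneSpectrum (NumberField.RingOfIntegers K) in Filter.cofinite, ρ.IsUnramifiedAt v) ∧ ∀ (v : IsDedekindDomain.HeightOneSpectrum (NumberField.RingOfIntegers K)) (hv : ((ℓ : ℕ) : NumberField.RingOfIntegers K) ∈ v.asIdeal), (Literature.NumberTheory.PAdicHodge.fontainePstAdicCompletion v ℓ hv).IsDeRhamFramed (ρ.toLocal v)) → (∀ᶠ v : IsDedekindDomain.HeightOneSpectrum (NumberField.RingOfIntegers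 K) in Filter.cofinite, Summit.Langlands.SatakeFrobCompatibleAt ι π.1 ρ v) → ∀ v : IsDedekindDomain.HeightOneSpectrum (NumberField.RingOfIntegers K), Summit.Langlands.LocalGlobalCompatibleAt Rec ι π.1 ρ v := by
  sorry

/-- **Stub — conjugacy of avatars** (THEOREM: Chebotarev + Brauer–Nesbitt + Jordan–Hölder: `ρ` irreducible and
`ρ'` with the same Frobenius polynomials a.e. ⇒ `ρ' ≃ ρ`). [cite: SerreAbelianLadic1968, I-11] -/
theorem stub_avatarConjugate :
    ∀ (K : Type) [Field K] [NumberField K] (Rec : Summit.Langlands.ReciprocityData K) (n : ℕ) (hcpt : Literature.NumberTheory.Automorphic.isCompact_glFiniteIntegralLevel n K) (ℓ : ℕ) [Fact ℓ.Prime] (ι : PadicAlgCl ℓ ≃+* ℂ) (π : Literature.NumberTheory.Automorphic.CuspidalAutomorphicRepData n K hcpt) (ρ ρ' : Literature.NumberTheory.GaloisRepresentations.FramedGaloisRep K (PadicAlgCl ℓ) n), ρ.toGaloisRep.IsIrreducible → Summit.Langlands.Corresponds Rec ι π.1 ρ → Summit.Langlands.Corresponds Rec ι π.1 ρ' → Summit.Langlands.IsConjugate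 ρ ρ' := by
  sorry

/-- **A′ from the stub STATEMENTS**, concluding the TEXT of the piece. -/
theorem automorphicToGaloisOfDatum_text_of
    (hW : ∀ (K : Type) [Field K] [NumberField K] (n : ℕ) (hcpt : Literature.NumberTheory.Automorphic.isCompact_glFiniteIntegralLevel n K), 0 < n → ∀ π : Literature.NumberTheory.Automorphic.CuspidalAutomorphicRepData n K hcpt, π.1.IsLAlgebraic → ∀ (ℓ : ℕ) [Fact ℓ.Prime] (ι : PadicAlgCl ℓ ≃+* ℂ), ∃ ρ : Literature.NumberTheory.GaloisRepresentations.FramedGaloisRep K (PadicAlgCl ℓ) n, ρ.toGaloisRep.IsIrreducible ∧ ((∀ᶠ v : IsDedekindDomain.HeightOneSpectrum (NumberField.RingOfIntegers K) in Filter.cofinite, ρ.IsUnramifiedAt v) ∧ ∀ (v : IsDedekindDomain.HeightOneSpectrum (NumberField.RingOfIntegers K)) (hv : ((ℓ : ℕ) : NumberField.RingOfIntegers K) ∈ v.asIdeal), (Literature.NumberTheory.PAdicHodge.fontainePstAdicCompletion v ℓ hv).IsDeRhamFramed (ρ.toLocal v)) ∧ ∀ᶠ v : IsDedekindDomain.HeightOneSpectrum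 (NumberField.RingOfIntegers K) in Filter.cofinite, Summit.Langlands.SatakeFrobCompatibleAt ι π.1 ρ v)
    (hL : ∀ (K : Type) [Field K] [NumberField K], Nonempty (Summit.Langlands.ReciprocityData K) → ∃ Rec : Summit.Langlands.ReciprocityData K, ∀ (n : ℕ) (hcpt : Literature.NumberTheory.Automorphic.isCompact_glFiniteIntegralLevel n K), 0 < n → ∀ (π : Literature.NumberTheory.Automorphic.CuspidalAutomorphicRepData n K hcpt), π.1.IsLAlgebraic → ∀ (ℓ : ℕ) [Fact ℓ.Prime] (ι : PadicAlgCl ℓ ≃+* ℂ) (ρ : Literature.NumberTheory.GaloisRepresentations.FramedGaloisRep K (PadicAlgCl ℓ) n), ρ.toGaloisRep.IsIrreducible → ((∀ᶠ v : IsDedekindDomain.HeightOneSpectrum (NumberField.RingOfIntegers K) in Filter.cofinite, ρ.IsUnramifiedAt v) ∧ ∀ (v : IsDedekindDomain.HeightOneSpectrum (NumberField.RingOfIntegers K)) (hv : ((ℓ : ℕ) : NumberField.RingOfIntegers K) ∈ v.asIdeal), (Literature.NumberTheory.PAdicHodge.fontainePstAdicCompletion v ℓ hv).IsDeRhamFramed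 (ρ.toLocal v)) → (∀ᶠ v : IsDedekindDomain.HeightOneSpectrum (NumberField.RingOfIntegers K) in Filter.cofinite, Summit.Langlands.SatakeFrobCompatibleAt ι π.1 ρ v) → ∀ v : IsDedekindDomain.HeightOneSpectrum (NumberField.RingOfIntegers K), Summit.Langlands.LocalGlobalCompatibleAt Rec ι π.1 ρ v)
    (hU : ∀ (K : Type) [Field K] [NumberField K] (Rec : Summit.Langlands.ReciprocityData K) (n : ℕ) (hcpt : Literature.NumberTheory.Automorphic.isCompact_glFiniteIntegralLevel n K) (ℓ : ℕ) [Fact ℓ.Prime] (ι : PadicAlgCl ℓ ≃+* ℂ) (π : Literature.NumberTheory.Automorphic.CuspidalAutomorphicRepData n K hcpt) (ρ ρ' : Literature.NumberTheory.GaloisRepresentations.FramedGaloisRep K (PadicAlgCl ℓ) n), ρ.toGaloisRep.IsIrreducible → Summit.Langlands.Corresponds Rec ι π.1 ρ → Summit.Langlands.Corresponds Rec ι π.1 ρ' → Summit.Langlands.IsConjugate ρ ρ') :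
    ∀ (F : Type) [Field F] [NumberField F], Nonempty (Summit.Langlands.ReciprocityData F) → ∃ Rec : Summit.Langlands.ReciprocityData F, ∀ n : ℕ, 0 < n → ∀ hcpt : Literature.NumberTheory.Automorphic.isCompact_glFiniteIntegralLevel n F, Summit.Langlands.AutomorphicToGalois n Rec hcpt := by
  intro F _ _ hne
  obtain ⟨Rec, hRec⟩ := hL F hne
  refine ⟨Rec, fun n hn hcpt π hLalg ℓ _ ι ↦ ?_⟩
  obtain ⟨ρ, hirr, hgeo, hsat⟩ := hW F n hcpt hn π hLalg ℓ ι
  have hcorr : Corresponds Rec ι π.1 ρ := ⟨hsat, hRec n hcpt hn π hLalg ℓ ι ρ hirr hgeo hsat⟩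
  exact ⟨ρ, hirr, hgeo, hcorr, fun ρ' h' ↦ hU F Rec n hcpt ℓ ι π ρ ρ' hirr hcorr h'⟩

/-- Skeleton composition on the texts (the only sorries are the three stubs). -/
theorem automorphicToGaloisOfDatum_text_proof :
    ∀ (F : Type) [Field F] [NumberField F], Nonempty (Summit.Langlands.ReciprocityData F) → ∃ Rec : Summit.Langlands.ReciprocityData F, ∀ n : ℕ, 0 < n → ∀ hcpt : Literature.NumberTheory.Automorphic.isCompact_glFiniteIntegralLevel n F, Summit.Langlands.AutomorphicToGalois n Rec hcpt :=
  automorphicToGaloisOfDatum_text_of stub_weakExistenceIrreducible stub_pairCompatibility stub_avatarConjugate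

end Summit.Langlands.Langlands.Cruxes.PhantomRMJunction.BirthA

end
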